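import Summits.NavierStokesRegularity.NavierStokesRegularity.Theorems.ScenarioCensusRowF1RingTopFloors
import HarnessLib

/-!
# LINE 44 «ring-top» port, part 6/6: §6 residual `RingCollapse` ≡ `Row_F1`, what the hypotheses admit (round jets, columns, the rest state); §7 summary; census KEYS `Row_F1rx` / `Row_F1krx` +
# `_excluded`, floors RGF / HRF

Re-homed for the scenario census (typer seat ns-census-typer-1 g10; the cells F1rx / F1krx and the floors are members of row F1 «DECIDED IN KERNEL IN FILES» (LINE 44: ref ns-census-ref g16
PRE-CHECK ✓ §21.18, critic PASS, lead booking OF RECORD at census v1.133); this port makes them TREE-decided): VERBATIM PORT of ns-idea-3 LINE 44 «ring-top»,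
`pub/ideators/ns-idea-3/lines/ring-top/line-ring-top.lean` sha16 74d818dbb34ba3da (1774 l., lean check rc 0, 0 sorry), split for the 400-line rule into `ScenarioCensusRowF1RingTop`
(§1) → `…RingTopZoom` (§2–§3) → `…RingTopCovariance` (§4a) → `…RingTopKill` (§4b) → `…RingTopFloors` (§5) → `…RingTopRows` (§6–§7 + census KEYS).  Lean text VERBATIM in namespace
`…Theorems.ScenarioCensus.RingTop` (the line's `…Cruxes.ScenarioCensusRowF1.RingTopLine` re-homed); port edits: the frame restated VERBATIM by the line from LINES 34–42 (`topSet`,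
`HasTypeIConstant`, `snapLevel`, `exists_fast_at`, `sqrt_mul_sq_mul`, `continuous_slice'`, `rotLin`, `rotCLM`, `coe_rotCLM`, `analyticAt_transport`, `rotZ_smul_eZ'`, `zoom_units`,
`eventually_forall_not_of_not_frequently`, `le_of_units`) is taken BY NAME from the landed ports (the line's own STRENGTHENED compactness / socket / zoom package / `tendsto_eval` with gradients are new statements and kept; `row_of_floor` = `ScalingTop.row_of_floor` BY NAME); elementary lemmas the line restates are the tree's BY NAME (`rotZ_add_vec'` / `rotZ_add_smul_eZ'` = `ScrewBlowdown.…`,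
`rotZ_smul_vec'` = `rotZ_smul`, `rotZ_neg_rotZ'` / `rotZ_rotZ_neg'` = `RotationOrder.…`, `rotZ_zero_vec'` = `rotZ_apply_zero_vec`, `curl_const_smul'` = `curl_const_smul_field`, `continuous_rotZ`,
`centre_mem` = `IsTypeIAncientMild.comp_add_right`, `hasDerivAt_rotZ_rotGen'` = `AxisymEndLiouville.AbsorbingAxisSwirlExtinction.hasDerivAt_rotZ_rotGen`, `rotGen_add_smul_eZ'` =
`PeriodicSlab.rotGen_add_smul_eZ`, `inner_gradient_eq_fderiv` = `Wu2026Salvage.inner_gradient_right_eq`, `rotZ_single_two` = `UnthreadedRigidity.ProfileHorn.rotZ_single_two'` — cone-free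
modules imported); `tendstoLocallyUniformly_comp_of_tendsto`, `analyticAt_linIso`, `smul_coord` (twins of lemmas in route-cone modules) are not re-declared (inlined / replaced by
`PiLp.smul_apply, smul_eq_mul`); `@[conjecture]` on the residual `RingCollapse` (≡ `ScenarioCensus.Row_F1`, OPEN); one-line docstrings added where missing (gate lint).  Statements untouched.

No census VALUE is moved here (row F1 stays OPEN-WITH-LINE; the members become TREE-decided by name); NS regularity is NOT proved; `Row_F1` is untouched (zero
movement, `ringCollapse_iff_rowF1`); no summit statement is proved by this file. Lemmas that restate already-landed tree declarations are taken BY NAME (gate lint `dedup.landed`): `topSet` = `TwoTimeTop.topSet`, `HasTypeIConstant` = `OneLevelTop.HasTypeIConstant`, `snapLevel` = `SnapshotTop.snapLevel`, `exists_fast_at` = `SnapshotTop.exists_fast_at`, `sqrt_mul_sq_mul` = `SnapshotTop.sqrt_mul_sq_mul`, `centre_mem` = `IsTypeIAncientMild.comp_add_right`, `continuous_slice'` = `ScalingTop.continuous_slice'`, `rotZ_add_vec'` = `ScrewBlowdown.rotZ_add_vec`, `rotZ_smul_vec'` = `rotZ_smul`, `rotZ_add_smul_eZ'` = `ScrewBlowdown.rotZ_add_smul_eZ`,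 `rotLin` = `ScrewTop.rotLin`, `rotCLM` = `ScrewTop.rotCLM`, `analyticAt_transport` = `ScrewTop.analyticAt_transport`, `rotZ_smul_eZ'` = `ScrewTop.rotZ_smul_eZ'`, `hasDerivAt_rotZ_rotGen'` = `AxisymEndLiouville.AbsorbingAxisSwirlExtinction.hasDerivAt_rotZ_rotGen`, `rotGen_add_smul_eZ'` = `PeriodicSlab.rotGen_add_smul_eZ`, `inner_gradient_eq_fderiv` = `Wu2026Salvage.inner_gradient_right_eq`, `rotZ_single_two` = `UnthreadedRigidity.ProfileHorn.rotZ_single_two'`, `rotZ_neg_rotZ'` = `RotationOrder.rotZ_neg_rotZ`, `rotZ_rotZ_neg'` = `RotationOrder.rotZ_rotZ_neg`, `rotZ_zero_vec'` = `rotZ_apply_zero_vec`, `curl_const_smul'` = `curl_const_smul_field`, `zoom_units` = `NeedleTop.zoom_units`, `eventually_forall_not_of_not_frequently` = `EchoTop.eventually_forall_not_of_not_frequently`, `le_of_units` = `ScalingTop.le_of_units`, `row_of_floor` = `ScalingTop.row_of_floor`.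
-/

-- the summit and its single problem share the name `NavierStokesRegularity` (D-0017 nested layout)
set_option linter.dupNamespace false

noncomputable section

open MeasureTheory Set Function Filter TopologicalSpace Metric
open scoped Topology NNReal ENNReal InnerProductSpace RealInnerProductSpace

namespace Summit.NavierStokesRegularity.NavierStokesRegularity.Theorems.ScenarioCensus.RingTop

open Literature.Analysis Literature.Analysis.FluidPDE
open Summit.NavierStokesRegularity.NavierStokesRegularity.Theorems
open Summit.NavierStokesRegularity.NavierStokesRegularity.Theses
open Summit.NavierStokesRegularity.NavierStokesRegularity.Theorems.LocalHelicityTubeDoorFrobeniusProfileRigidityHelicalSlice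
open Summit.NavierStokesRegularity.NavierStokesRegularity.Theorems.NearExtremalTransiencePerFlow.FilamentSelection
open Summit.NavierStokesRegularity.NavierStokesRegularity.Theorems.LocalSineTubeDoorProfileAlignedWindowRigidityAncient

/-! ## §6 The residual ≡ row F1 (declared); what the hypotheses admit; summary -/

/-- The census-row threshold `ringLevel M c_S L A a` decides the row. -/
theorem ringLevel_spec {M : ℝ} {L : E3 ≃ₗᵢ[ℝ] E3} {A a : ℝ} (ha : 0 < a)
    (ν T : ℝ) (hν : 0 < ν) (hT : 0 < T) (u : ℝ → E3 → E3) (p : ℝ → E3 → ℝ)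
    (hsol : IsClassicalNSSolutionOn (Ico 0 T) ν 0 u p) (hLH : IsLerayHopfOn T ν 0 (u 0) u)
    (hdec : HasRapidSpatialDecay (u 0)) (hM : OneLevelTop.HasTypeIConstant ν T M u)
    (hfreq : ∃ᶠ t in 𝓝[<] T, ∀ x ∈ TwoTimeTop.topSet ν T u SnapshotTop.snapLevel t, RingPocketAt ν T u L A a (ringLevel M SnapshotTop.snapLevel L A a) t x) :
    HasSmoothExtensionPast ν 0 u T := by
  have hp : 0 < SnapshotTop.snapLevel ∧ 0 < a := ⟨SnapshotTop.snapLevel_pos, ha⟩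
  have hspec := (Classical.choose_spec (ringFloor_holds M SnapshotTop.snapLevel L A a hp.1 hp.2)).2 ν T hν hT u p hsol hLH hdec hM
  have hlev : ringLevel M SnapshotTop.snapLevel L A a = Classical.choose (ringFloor_holds M SnapshotTop.snapLevel L A a hp.1 hp.2) := by
    unfold ringLevel
    rw [dif_pos hp]
  rw [hlev] at hfreq
  exact ScalingTop.row_of_floor hν hT hsol hLH hdec hspec hfreq

/-- **Residual «RING COLLAPSE»** (maximal frame): every maximal Type-I Clay blow-up with constant `M` admits, for SOME frame `L`, reach
`A` and radius `a > 0`, ring pockets at the threshold `ringLevel M c_S L A a` at every `c_S`-fast point along some `t_k ↑ T`.  DECLARED ≡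
row F1 (`ringCollapse_iff_rowF1`); no movement on `Row_F1` is claimed. -/
@[conjecture] def RingCollapse : Prop :=
  ∀ (ν T : ℝ), 0 < ν → 0 < T → ∀ (u : ℝ → E3 → E3) (p : ℝ → E3 → ℝ),
    IsMaximalSmoothSolution ν 0 u p T → IsLerayHopfOn T ν 0 (u 0) u → HasRapidSpatialDecay (u 0) →
    ∀ M : ℝ, OneLevelTop.HasTypeIConstant ν T M u →
      ∃ (L : E3 ≃ₗᵢ[ℝ] E3) (A a : ℝ), 0 < a ∧
        ∃ᶠ t in 𝓝[<] T, ∀ x ∈ TwoTimeTop.topSet ν T u SnapshotTop.snapLevel t, RingPocketAt ν T u L A a (ringLevel M SnapshotTop.snapLevel L A a) t x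

/-- **The split**: ring row (proved) + residual ⇒ row F1 (target BY NAME). -/
theorem rowF1_of_ringCollapse (hR : RingCollapse) : ScenarioCensus.Row_F1 := by
  unfold ScenarioCensus.Row_F1
  intro ν T hν hT u p hsol hLH hdec hTI
  by_contra hext
  obtain ⟨M, hM⟩ := OneLevelTop.exists_hasTypeIConstant hν hTI
  obtain ⟨L, A, a, ha, hfreq⟩ := hR ν T hν hT u p ⟨hsol, hext⟩ hLH hdec M hM
  exact hext (ringLevel_spec ha ν T hν hT u p hsol hLH hdec hM hfreq)

/-- The residual is a consequence of row F1 (vacuously). -/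
theorem ringCollapse_of_rowF1 (hrow : ScenarioCensus.Row_F1) : RingCollapse :=
  fun ν T hν hT u p hmax hLH hdec _ hM =>
    (hmax.2 (hrow ν T hν hT u p hmax.1 hLH hdec hM.isTypeIBlowup)).elim

/-- Residual ≡ row F1 (declared). -/
theorem ringCollapse_iff_rowF1 : RingCollapse ↔ ScenarioCensus.Row_F1 :=
  ⟨rowF1_of_ringCollapse, ringCollapse_of_rowF1⟩

/-! ### What the hypotheses admit (hypothesis level): NOTHING is asked to be small, slow or symmetric — not even on the pocket.  Exact
members in closed form, at ANY amplitude: the round jet `ρ² e₂` (`ρ² = w₀² + w₁²`; vorticity `−2Jw`: coaxial circles; at rest at the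
apex) is an exact ring top but NOT a circular top of LINE 43 (its streamlines are axial: circular defect `ρ²`); the PLANAR STRAIN
`α(w₀e₀ − w₁e₁)` (irrotational, at rest on the axis) is an exact ring top AND an exact helical ring top of every pitch, yet it SWIRLS
(`−2αw₀w₁`) and has no rotational / helical symmetry: the vortex-line cells are not sub-cells of the symmetry cells of LINES 41/42/43 even
at accuracy `0`; the swirling column `αJw + βe₂` — an exact whirl pocket of LINE 42 and an exact circular top of LINE 43 — has ring
defect `2|α|` at `e₀` (its vortex lines are AXIAL): not a member; the «swirling Poiseuille flow» `hJw − ρ²e₂` has vorticity `2ξ_h` and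
vanishes on the axis: an exact helical ring top of pitch `h`.  The content of the floors is on the LIMIT side (§4). -/

/-- The coordinate projections as continuous linear maps. -/
def proj (i : Fin 3) : E3 →L[ℝ] ℝ := EuclideanSpace.proj i

/-- Component / evaluation formula (`proj_apply`). -/
@[simp] theorem proj_apply (i : Fin 3) (v : E3) : proj i v = v i := rfl

/-- The squared cylindrical radius `ρ²(w) = w₀² + w₁²`. -/
def rhoSq (w : E3) : ℝ := w 0 * w 0 + w 1 * w 1

/-- Its derivative. -/
def rhoSqD (w : E3) : E3 →L[ℝ] ℝ := proj 0 w • proj 0 + proj 0 w • proj 0 + (proj 1 w • proj 1 + proj 1 w • proj 1)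

/-- Derivative computation (`hasFDerivAt_rhoSq`). -/
theorem hasFDerivAt_rhoSq (w : E3) : HasFDerivAt rhoSq (rhoSqD w) w :=
  ((proj 0).hasFDerivAt.mul (proj 0).hasFDerivAt).add ((proj 1).hasFDerivAt.mul (proj 1).hasFDerivAt)

/-- Component / evaluation formula (`rhoSqD_apply`). -/
@[simp] theorem rhoSqD_apply (w v : E3) : rhoSqD w v = 2 * w 0 * v 0 + 2 * w 1 * v 1 := by
  simp only [rhoSqD, FunLike.coe_add, FunLike.coe_smul, Pi.add_apply, Pi.smul_apply, proj_apply, smul_eq_mul]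
  ring

/-- **The round jet** `V(w) = ρ²(w) e₂` (Poiseuille profile; any other radial profile behaves the same way). -/
def roundJet (w : E3) : E3 := rhoSq w • eZ

/-- Derivative computation (`hasFDerivAt_roundJet`). -/
theorem hasFDerivAt_roundJet (w : E3) : HasFDerivAt roundJet ((rhoSqD w).smulRight eZ) w :=
  (hasFDerivAt_rhoSq w).smul_const eZ

/-- The vorticity of the round jet is `−2Jw`: its vortex lines are the coaxial circles. -/
theorem curl_roundJet (w : E3) : curl roundJet w = (-2 : ℝ) • rotGen w := by
  rw [curl_eq_curlCLM, (hasFDerivAt_roundJet w).fderiv, curlCLM_apply]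
  ext i
  fin_cases i <;> simp [eZ]

/-- The vorticity of the rigid rotation `Jw` is `2e₂`. -/
theorem curl_rotGen (w : E3) : curl rotGen w = (2 : ℝ) • eZ := by
  rw [curl_eq_curlCLM, (hasFDerivAt_rotGen w).fderiv, curlCLM_apply]
  ext i
  fin_cases i
  · simp [eZ, rotGen]
  · simp [eZ, rotGen]
  · simp [eZ, rotGen]
    norm_num

/-- **The round jet is an exact ring top at every point** (vortex lines = coaxial circles; at rest at the apex). -/
theorem ringDefect_roundJet (w : E3) : ringDefect w (roundJet w) (curl roundJet w) = 0 := by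
  rw [curl_roundJet, ringDefect_eq_zero_iff]
  refine ⟨⟨by simp [rotGen], ?_⟩, ?_⟩
  · simp only [PiLp.smul_apply, smul_eq_mul, rotGen_apply_zero, rotGen_apply_one]
    ring
  · by_cases hw : w = 0
    · subst hw
      simp [apexPin_zero, roundJet, rhoSq, eZ]
    · exact apexPin_of_ne_zero hw _

/-- … but it is NOT a circular top of LINE 43: its streamlines are axial, circular defect `ρ²`. -/
theorem circDefect_roundJet (w : E3) : circDefect w (roundJet w) = rhoSq w := by
  have h : 0 ≤ rhoSq w := by unfold rhoSq; nlinarith [sq_nonneg (w 0), sq_nonneg (w 1)]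
  simp [circDefect, roundJet, eZ, abs_of_nonneg h]

/-- **The swirling column `αJw + βe₂`** (LINE 42's exact whirl pocket, LINE 43's exact circular top). -/
def column (α β : ℝ) (w : E3) : E3 := α • rotGen w + β • eZ

/-- Auxiliary lemma of the line, stated and proved verbatim (`curl_column`). -/
theorem curl_column (α β : ℝ) (w : E3) : curl (column α β) w = (2 * α) • eZ := by
  have hf : DifferentiableAt ℝ (fun y : E3 => α • rotGen y) w := (hasFDerivAt_rotGen w).differentiableAt.const_smul α
  have hg : DifferentiableAt ℝ (fun _ : E3 => β • eZ) w := differentiableAt_const _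
  have h0 : curl (fun _ : E3 => β • eZ) w = 0 := curl_eq_zero_of_fderiv_eq_zero (by simp)
  show curl (fun y => α • rotGen y + β • eZ) w = (2 * α) • eZ
  rw [curl_add hf hg, curl_const_smul (hasFDerivAt_rotGen w).differentiableAt, curl_rotGen, h0, add_zero, smul_smul, mul_comm]

/-- `e₀ ≠ 0`. -/
theorem single_zero_ne_zero : EuclideanSpace.single 0 (1 : ℝ) ≠ (0 : E3) := by
  intro h
  simpa using congrArg (fun v : E3 => v 0) h

/-- … is NOT a ring top when it swirls: at the unit point `e₀` its ring defect is `2|α|` (AXIAL vortex lines `2αe₂`: circular defect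
`2|α|`; no pin off the apex) — LINE 42's exact whirl pocket / LINE 43's exact circular top is not in the ring cell. -/
theorem ringDefect_column (α β : ℝ) :
    ringDefect (EuclideanSpace.single 0 (1 : ℝ)) (column α β (EuclideanSpace.single 0 (1 : ℝ)))
      (curl (column α β) (EuclideanSpace.single 0 (1 : ℝ))) = 2 * |α| := by
  rw [curl_column, ringDefect, apexPin_of_ne_zero single_zero_ne_zero, add_zero]
  simp [circDefect, eZ, abs_mul]

/-- **The planar strain `α(w₀e₀ − w₁e₁)`** — irrotational, at rest on the axis, NOT rotationally or helically symmetric (only under the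
half-turn), WITH swirl `−2αw₀w₁`. -/
def strain (α : ℝ) (w : E3) : E3 := (α * w 0) • EuclideanSpace.single 0 (1 : ℝ) - (α * w 1) • EuclideanSpace.single 1 (1 : ℝ)

/-- The strain as a continuous linear map. -/
def strainL (α : ℝ) : E3 →L[ℝ] E3 := (α • proj 0).smulRight (EuclideanSpace.single 0 (1 : ℝ)) -
  (α • proj 1).smulRight (EuclideanSpace.single 1 (1 : ℝ))

/-- Component / evaluation formula (`strainL_apply`). -/
theorem strainL_apply (α : ℝ) (w : E3) : strainL α w = strain α w := by
  simp [strainL, strain, proj_apply]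

/-- Derivative computation (`hasFDerivAt_strain`). -/
theorem hasFDerivAt_strain (α : ℝ) (w : E3) : HasFDerivAt (strain α) (strainL α) w := by
  have h : strain α = fun w => strainL α w := funext fun w => (strainL_apply α w).symm
  rw [h]
  exact (strainL α).hasFDerivAt

/-- The strain is irrotational. -/
theorem curl_strain (α : ℝ) (w : E3) : curl (strain α) w = 0 := by
  rw [curl_eq_curlCLM, (hasFDerivAt_strain α w).fderiv, curlCLM_apply]
  ext i
  fin_cases i <;> simp [strainL_apply, strain]

/-- The strain vanishes on the axis. -/
theorem strain_onAxis (α : ℝ) {w : E3} (hw : w 0 = 0 ∧ w 1 = 0) : strain α w = 0 := by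
  simp [strain, hw.1, hw.2]

/-- **The planar strain is an exact ring top at every point** (no vorticity at all; apex at rest) … -/
theorem ringDefect_strain (α : ℝ) (w : E3) : ringDefect w (strain α w) (curl (strain α) w) = 0 := by
  rw [curl_strain, ringDefect_eq_zero_iff]
  refine ⟨⟨by simp, by simp⟩, ?_⟩
  by_cases hw : w = 0
  · subst hw
    rw [strain_onAxis α ⟨by simp, by simp⟩, apexPin_zero]
    simp
  · exact apexPin_of_ne_zero hw _

/-- … and an exact helical ring top of every pitch at every point (at rest on the axis) … -/
theorem helRingDefect_strain (h α : ℝ) (w : E3) : helRingDefect h w (strain α w) (curl (strain α) w) = 0 := by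
  rw [curl_strain, helRingDefect_eq_zero_iff]
  refine ⟨⟨by simp, by simp⟩, ?_⟩
  by_cases hw : w 0 = 0 ∧ w 1 = 0
  · rw [strain_onAxis α hw, axisPin_of_onAxis hw]
    simp
  · exact axisPin_of_offAxis hw _

/-- … yet it SWIRLS (`w₀V₁ − w₁V₀ = −2αw₀w₁`) and is not equivariant under any rotation other than the half-turn: the vortex-line cells
are NOT sub-cells of the symmetry cells of LINES 41/42, even at accuracy `0`, at the level of the hypotheses. -/
theorem strain_swirl (α : ℝ) (w : E3) : w 0 * strain α w 1 - w 1 * strain α w 0 = -2 * α * w 0 * w 1 := by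
  simp [strain]
  ring

/-- **The swirling Poiseuille flow of pitch `h`**: `V(w) = hJw − ρ²(w)e₂`. -/
def swirlPoiseuille (h : ℝ) (w : E3) : E3 := h • rotGen w - rhoSq w • eZ

/-- Its vorticity is `2ξ_h = 2(Jw + he₂)`: the vortex lines are the coaxial helices of pitch `h`. -/
theorem curl_swirlPoiseuille (h : ℝ) (w : E3) : curl (swirlPoiseuille h) w = (2 : ℝ) • (rotGen w + h • eZ) := by
  have hf : DifferentiableAt ℝ (fun y : E3 => h • rotGen y) w := (hasFDerivAt_rotGen w).differentiableAt.const_smul h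
  have hg : DifferentiableAt ℝ roundJet w := (hasFDerivAt_roundJet w).differentiableAt
  show curl (fun y => h • rotGen y - roundJet y) w = (2 : ℝ) • (rotGen w + h • eZ)
  rw [curl_sub hf hg, curl_const_smul (hasFDerivAt_rotGen w).differentiableAt, curl_rotGen, curl_roundJet, smul_smul, neg_smul,
    sub_neg_eq_add, smul_add, smul_smul, mul_comm h 2, add_comm]

/-- **The swirling Poiseuille flow is an exact helical ring top of pitch `h` at every point** (vortex lines = the helices; at rest on
the axis). -/
theorem helRingDefect_swirlPoiseuille (h : ℝ) (w : E3) :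
    helRingDefect h w (swirlPoiseuille h w) (curl (swirlPoiseuille h) w) = 0 := by
  rw [curl_swirlPoiseuille, helRingDefect_eq_zero_iff]
  refine ⟨⟨?_, ?_⟩, ?_⟩
  · simp [rotGen, eZ]
    ring
  · simp [rotGen, eZ]
    ring
  · by_cases hw : w 0 = 0 ∧ w 1 = 0
    · rw [axisPin_of_onAxis hw]
      simp [swirlPoiseuille, rhoSq, rotGen, eZ, hw.1, hw.2]
    · exact axisPin_of_offAxis hw _

/-- **PLANTED WITNESS (any first-order defect)**: if `V : ℝ³ → ℝ³` has `D w (V w) (curl V w) = 0` everywhere, the field whose snapshot at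
each instant `t' < T` is the self-similarly collapsing copy `y ↦ L V(L⁻¹(y − x)/ℓ(t'))` has a `D`-vortex pocket of accuracy `0` about `x`
(apex `b = 0`) at every instant `t < T`, for every reach `A ≥ 0` and radius `a` — at ANY amplitude of `V` (the conjugated snapshot in
apex coordinates IS `V`). -/
theorem vortexPocketAt_of_planted (D : E3 → E3 → E3 → ℝ) {V : E3 → E3} (hV : ∀ w, D w (V w) (curl V w) = 0)
    (L : E3 ≃ₗᵢ[ℝ] E3) (x : E3) {ν T t A a : ℝ} (hν : 0 < ν) (ht : t < T) (hA : 0 ≤ A) :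
    VortexPocketAt D ν T (fun t' y => L (V ((Real.sqrt (ν * (T - t')))⁻¹ • L.symm (y - x)))) L A a 0 t x := by
  refine ⟨0, by simpa using hA, fun w _ => ?_⟩
  have hℓ : Real.sqrt (ν * (T - t)) ≠ 0 := (Real.sqrt_pos.2 (mul_pos hν (sub_pos.2 ht))).ne'
  have e : ∀ w' : E3,
      (Real.sqrt (ν * (T - t)))⁻¹ • L.symm ((x + Real.sqrt (ν * (T - t)) • ((0 : E3) + L w')) - x) = w' := by
    intro w'
    rw [zero_add, add_sub_cancel_left, LinearIsometryEquiv.map_smul, LinearIsometryEquiv.symm_apply_apply, smul_smul,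
      inv_mul_cancel₀ hℓ, one_smul]
  have eF : (fun w' : E3 =>
      L.symm (L (V ((Real.sqrt (ν * (T - t)))⁻¹ • L.symm ((x + Real.sqrt (ν * (T - t)) • ((0 : E3) + L w')) - x))))) = V := by
    funext w'
    rw [LinearIsometryEquiv.symm_apply_apply, e]
  rw [eF, LinearIsometryEquiv.symm_apply_apply, e, hV, mul_zero, zero_mul]

/-- **RING WITNESS in closed form**: the self-similarly collapsing round jet planted at `x` (any frame) is an exact ring top at every
instant `t < T` — at full speed. -/
theorem ringPocketAt_of_roundJet {ν T t : ℝ} (hν : 0 < ν) (ht : t < T) (L : E3 ≃ₗᵢ[ℝ] E3) (x : E3) {A a : ℝ} (hA : 0 ≤ A) :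
    RingPocketAt ν T (fun t' y => L (roundJet ((Real.sqrt (ν * (T - t')))⁻¹ • L.symm (y - x)))) L A a 0 t x :=
  vortexPocketAt_of_planted ringDefect ringDefect_roundJet L x hν ht hA

/-- **HELICAL RING WITNESS in closed form**: the self-similarly collapsing swirling Poiseuille flow of pitch `h` planted at `x` is an
exact helical ring top of pitch `h` at every instant `t < T` — at full speed. -/
theorem helicalRingPocketAt_of_swirlPoiseuille {ν T t : ℝ} (hν : 0 < ν) (ht : t < T) (L : E3 ≃ₗᵢ[ℝ] E3) (h : ℝ) (x : E3)
    {A a : ℝ} (hA : 0 ≤ A) :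
    HelicalRingPocketAt ν T (fun t' y => L (swirlPoiseuille h ((Real.sqrt (ν * (T - t')))⁻¹ • L.symm (y - x)))) L h A a 0 t x :=
  vortexPocketAt_of_planted (helRingDefect h) (helRingDefect_swirlPoiseuille h) L x hν ht hA

/-- The rest state has both read-outs with accuracy `0` (and an empty top). -/
theorem pockets_rest {ν T : ℝ} (L : E3 ≃ₗᵢ[ℝ] E3) {h A a t : ℝ} (hA : 0 ≤ A) (x : E3) :
    RingPocketAt ν T (fun _ _ => 0) L A a 0 t x ∧ HelicalRingPocketAt ν T (fun _ _ => 0) L h A a 0 t x := by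
  have hc : ∀ w : E3, curl (fun _ : E3 => L.symm 0) w = 0 := fun w => curl_eq_zero_of_fderiv_eq_zero (by simp)
  refine ⟨⟨0, by simpa using hA, fun w _ => ?_⟩, ⟨0, by simpa using hA, fun w _ => ?_⟩⟩
  · rw [hc, LinearIsometryEquiv.map_zero, show ringDefect w 0 0 = 0 by simp [ringDefect, circDefect, apexPin], mul_zero, zero_mul]
  · rw [hc, LinearIsometryEquiv.map_zero, show helRingDefect h w 0 0 = 0 by simp [helRingDefect, corkDefect, axisPin],
      mul_zero, zero_mul]

/-- Monotonicity of the vortex-line read-out in the threshold. -/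
theorem vortexPocketAt_mono {D : E3 → E3 → E3 → ℝ} {ν T : ℝ} {u : ℝ → E3 → E3} {L : E3 ≃ₗᵢ[ℝ] E3} {A a ε ε' t : ℝ} {x : E3}
    (hle : ε ≤ ε') (hν : 0 ≤ Real.sqrt ν) (hP : VortexPocketAt D ν T u L A a ε t x) : VortexPocketAt D ν T u L A a ε' t x := by
  obtain ⟨b, hb, hp⟩ := hP
  exact ⟨b, hb, fun w hw => (hp w hw).trans (mul_le_mul_of_nonneg_right hle hν)⟩

/-! ## §7 Summary -/

/-- **LINE 44 «ring-top», summary.**  In kernel, standard axioms: the two FLOORS (universal over fast points, every level `Λ`), the two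
census ROWS (ring tops; helical ring tops of every pitch `h ≠ 0`), and the declared residual `RingCollapse ↔ Row_F1`. -/
theorem ringTop_summary :
    RingFloor ∧ HelicalRingFloor ∧ Row_F1rx ∧ Row_F1krx ∧ (RingCollapse ↔ ScenarioCensus.Row_F1) :=
  ⟨ringFloor_holds, helicalRingFloor_holds, rowF1rx_holds, rowF1krx_holds, ringCollapse_iff_rowF1⟩

end Summit.NavierStokesRegularity.NavierStokesRegularity.Theorems.ScenarioCensus.RingTop

namespace Summit.NavierStokesRegularity.NavierStokesRegularity.Theorems.ScenarioCensus

/-! ## Census KEYS (ns `…Theorems.ScenarioCensus`): the VORTEX-LINE members of row F1 (LINE 44) — TREE-decided F1rx / F1krx and floors RGF / HRF -/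

/-- **Cell F1rx — RING TOPS** (Type I with constant `M` · along some `t_k ↑ T` every `c_S`-fast point has an apex and a pocket on which the VORTEX LINES of the snapshot are `ε`-tangent to the circles about an axis, with the point pins ⇒ smooth extension past `T`): `:= RingTop.Row_F1rx`. DECIDED. -/
def Row_F1rx : Prop := RingTop.Row_F1rx
/-- F1rx is EXCLUDED (decided in the tree): `RingTop.rowF1rx_holds`. -/
theorem row_F1rx_excluded : Row_F1rx := RingTop.rowF1rx_holds

/-- **Cell F1krx — HELICAL RING TOPS** (vortex lines `ε`-tangent to the helices of pitch `h ≠ 0`): `:= RingTop.Row_F1krx`. DECIDED. -/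
def Row_F1krx : Prop := RingTop.Row_F1krx
/-- F1krx is EXCLUDED (decided in the tree): `RingTop.rowF1krx_holds`. -/
theorem row_F1krx_excluded : Row_F1krx := RingTop.rowF1krx_holds

/-- **Floor RGF — the RING floor** (universal over fast points, every level; no maximality hypothesis): `RingTop.ringFloor_holds`. -/
theorem row_F1_ringFloor : RingTop.RingFloor := RingTop.ringFloor_holds
/-- **Floor HRF — the HELICAL RING floor**: `RingTop.helicalRingFloor_holds`. -/
theorem row_F1_helicalRingFloor : RingTop.HelicalRingFloor := RingTop.helicalRingFloor_holds

end Summit.NavierStokesRegularity.NavierStokesRegularity.Theorems.ScenarioCensus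

end
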